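import Literature.Topology.FourManifolds.SpinSphereAmbient
import Literature.Topology.FourManifolds.SmoothOrientationSphereProofs
import HarnessLib

/-!
# Spheres are stably parallelizable and spin (discharges)

Sixth proof file of the `SpinSphere*` family attached to `Literature/Topology/FourManifolds/Spin.lean`.
It discharges, sorry-free, the two named facts of `Spin.lean` about spheres:

* `Literature.Topology.FourManifolds.isStablyParallelizable_sphere_holds : isStablyParallelizable_sphere` —
  every sphere `𝕊ⁿ ⊂ ℝⁿ⁺¹` is stably parallelizable (a *π-manifold*): `T𝕊ⁿ ⊕ ℝ` admits a global
  continuous framing (Kosinski, *Differential Manifolds*, Ch. IX §7, Def. 7.1 and the remark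
  following it, p. 187: "Obvious examples of π-manifolds are provided by spheres of all
  dimensions"; Kervaire–Milnor, *Groups of homotopy spheres I* (1963), §3; Milnor–Stasheff,
  *Characteristic Classes*, §2–3: `τ(𝕊ⁿ) ⊕ ν = ε^{n+1}` with `ν` the trivial normal line bundle);
* `Literature.Topology.FourManifolds.isSpin_sphere_holds : isSpin_sphere` — every sphere is spin
  (orientable, `isOrientable_sphere_holds`, and stably parallelizable;
  `isSpin_of_isStablyParallelizable`).

## Proof

The printed argument: the normal bundle `ν` of `𝕊ⁿ ⊂ ℝⁿ⁺¹` is the trivial line bundle spanned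
by the position vector, and `τ(𝕊ⁿ) ⊕ ν = Tℝⁿ⁺¹|_{𝕊ⁿ} = 𝕊ⁿ × ℝⁿ⁺¹`; so the constant frame
`e₀, …, eₙ` of `ℝⁿ⁺¹`, decomposed into tangential and normal parts, frames `τ ⊕ ε¹`:
`sᵢ(x) = (eᵢ - ⟪x, eᵢ⟫ x, ⟪x, eᵢ⟫)`.

For Mathlib's abstract tangent bundle `TangentBundle (𝓡 n) 𝕊ⁿ` (fibre `EuclideanSpace ℝ (Fin n)`,
stereographic charts) the tangential part has to be *lifted* through the injective differential
of the inclusion `D(incl)(x) : T_x 𝕊ⁿ → F` (range `(ℝ x)ᗮ`, `range_mfderiv_coe_sphere`). This is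
exactly the infrastructure of `SpinSphereAmbient.lean`: the tangent lift `L x : F → T_x 𝕊ⁿ` with
`D(incl)(x) (L x w) = w - ⟪x, w⟫ x` (`exists_linear_lift_mfderiv_coe_sphere`) and the continuity of
`x ↦ ⟨x, L x (w x)⟩` into the total space for continuous `w` (`continuous_totalSpaceMk_lift_sphere`,
i.e. `T(incl)` is a topological embedding). The sections are `sᵢ(x) = (L x eᵢ, ⟪x, eᵢ⟫)`; they are
pointwise linearly independent because the linear map `Φₓ(v, t) = D(incl)(x) v + t x` sends
`sᵢ(x)` to `(eᵢ - ⟪x, eᵢ⟫ x) + ⟪x, eᵢ⟫ x = eᵢ`, a linearly independent family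
(`LinearIndependent.of_comp`).

Design: theorems only (no definitions, instances or notation). The general statement is over a
real inner product space `F` with `[Fact (finrank ℝ F = n + 1)]` as in Mathlib's sphere API; the
named facts concern `F = EuclideanSpace ℝ (Fin (n + 1))`, with the `Fact` supplied by `haveI`.

## References

* A. A. Kosinski, *Differential Manifolds*, Pure and Applied Mathematics 138, Academic Press
  (1993), Ch. IX §1 (Def. 1.3: stably trivial, stable tangent bundle) and §7 (Def. 7.1 and
  remark, p. 187). [Kosinski1993]
* M. Kervaire, J. Milnor, *Groups of homotopy spheres I*, Ann. of Math. 77 (1963), 504–537, §3.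
  [KervaireMilnor1963]
* J. Milnor, J. Stasheff, *Characteristic Classes*, Ann. of Math. Studies 76 (1974), §2–3.
* H. B. Lawson, M.-L. Michelsohn, *Spin Geometry* (1989), Ch. II, Thm 2.1 and the examples
  following it (`w(T𝕊ⁿ) = 1`). [LawsonMichelsohn1989]
-/

open scoped Manifold ContDiff Topology InnerProductSpace
open Set Module Bundle Function Metric

noncomputable section

namespace Literature.Topology.FourManifolds

section Framing

variable {F : Type*} [NormedAddCommGroup F] [InnerProductSpace ℝ F] {n : ℕ}
  [Fact (finrank ℝ F = n + 1)]

/-- **The stable framing of a sphere induced by a frame of the ambient space.** Let `𝕊ⁿ ⊂ F`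
(`dim F = n + 1`) and let `e : ι → F` be linearly independent. Then the sections
`sᵢ(x) = (L x (e i), ⟪x, e i⟫)` of `T𝕊ⁿ ⊕ ℝ` — tangential part of `e i` lifted to Mathlib's
`T_x 𝕊ⁿ` through `D(incl)(x)`, and normal component of `e i` — are continuous (the first into the
total space `TangentBundle (𝓡 n) 𝕊ⁿ`) and linearly independent at every point: the linear map
`(v, t) ↦ D(incl)(x) v + t x` sends `sᵢ(x)` to `e i`. This is `τ(𝕊ⁿ) ⊕ ν ≅ ε^{n+1}` with the
normal line bundle `ν` trivialised by the position vector (Milnor–Stasheff, *Characteristic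
Classes*, §3; Kosinski, *Differential Manifolds*, Ch. IX §7). [cite: Kosinski1993, Ch. IX §7, Def. 7.1 and remark p. 187] -/
theorem exists_stableFraming_sphere {ι : Type*} {e : ι → F} (he : LinearIndependent ℝ e) :
    ∃ s : ι → sphere (0 : F) 1 → EuclideanSpace ℝ (Fin n) × ℝ,
      (∀ i, Continuous fun x ↦ (TotalSpace.mk' (EuclideanSpace ℝ (Fin n)) x (s i x).1 :
        TangentBundle (𝓡 n) (sphere (0 : F) 1))) ∧
      (∀ i, Continuous fun x ↦ (s i x).2) ∧ ∀ x, LinearIndependent ℝ fun i ↦ s i x := by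
  obtain ⟨L, hL⟩ := exists_linear_lift_mfderiv_coe_sphere (F := F) (n := n)
  refine ⟨fun i x ↦ (L x (e i), ⟪(x : F), e i⟫_ℝ), fun i ↦ ?_, fun i ↦ ?_, fun x ↦ ?_⟩
  · exact continuous_totalSpaceMk_lift_sphere (fun x ↦ ⇑(L x)) hL continuous_id continuous_const
  · exact continuous_subtype_val.inner continuous_const
  · -- `Φ (v, t) = D(incl)(x) v + t • x` recovers `e i` from `sᵢ(x)`
    let D : EuclideanSpace ℝ (Fin n) →ₗ[ℝ] F :=
      (mfderiv (𝓡 n) 𝓘(ℝ, F) ((↑) : sphere (0 : F) 1 → F) x).toLinearMap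
    have hD : ∀ v, D v = mfderiv (𝓡 n) 𝓘(ℝ, F) ((↑) : sphere (0 : F) 1 → F) x v := fun v ↦ rfl
    let Φ : (EuclideanSpace ℝ (Fin n) × ℝ) →ₗ[ℝ] F :=
      D.coprod (LinearMap.toSpanSingleton ℝ F (x : F))
    have hΦ : (⇑Φ ∘ fun i ↦ (L x (e i), ⟪(x : F), e i⟫_ℝ)) = e := by
      funext i
      change D (L x (e i)) + ⟪(x : F), e i⟫_ℝ • (x : F) = e i
      rw [hD, hL, sub_add_cancel]
    refine LinearIndependent.of_comp Φ ?_
    rw [hΦ]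
    exact he

/-- **A sphere in an inner product space is stably parallelizable**: `T𝕊ⁿ ⊕ ℝ` admits a global
continuous framing, for `𝕊ⁿ ⊂ F`, `dim F = n + 1` (apply `exists_stableFraming_sphere` to a
basis of `F`, reindexed by `Fin (finrank ℝ ℝⁿ + 1) = Fin (n + 1)`). Kosinski, *Differential
Manifolds*, Ch. IX §7: "Obvious examples of π-manifolds are provided by spheres of all
dimensions". [cite: Kosinski1993, Ch. IX §7, Def. 7.1 and remark p. 187] -/
theorem isStablyParallelizable_sphere_of_fact :
    IsStablyParallelizable (𝓡 n) (sphere (0 : F) 1) := by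
  haveI : FiniteDimensional ℝ F := .of_fact_finrank_eq_succ n
  have hN : finrank ℝ (EuclideanSpace ℝ (Fin n)) + 1 = finrank ℝ F := by
    rw [finrank_euclideanSpace_fin, Fact.out (p := finrank ℝ F = n + 1)]
  let b := Module.finBasis ℝ F
  have he : LinearIndependent ℝ fun i : Fin (finrank ℝ (EuclideanSpace ℝ (Fin n)) + 1) ↦
      b (Fin.cast hN i) :=
    b.linearIndependent.comp (Fin.cast hN) (Fin.cast_injective hN)
  obtain ⟨s, hs, hs', hli⟩ := exists_stableFraming_sphere (F := F) (n := n) he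
  exact ⟨s, hs, hs', hli⟩

end Framing

/-! ### The unit spheres `𝕊ⁿ ⊂ ℝⁿ⁺¹` -/

section Spheres

/-- **Every sphere `𝕊ⁿ = Metric.sphere (0 : EuclideanSpace ℝ (Fin (n + 1))) 1` is stably
parallelizable**: discharge of the named fact `Literature.Topology.FourManifolds.isStablyParallelizable_sphere` of
`Spin.lean` (`T𝕊ⁿ ⊕ ℝ ≅ 𝕊ⁿ × ℝⁿ⁺¹` via the outward normal). Kosinski, *Differential Manifolds*,
Ch. IX §7, Def. 7.1 and remark p. 187; Kervaire–Milnor 1963, §3. [cite: Kosinski1993, Ch. IX §7, Def. 7.1 and remark p. 187] -/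
theorem isStablyParallelizable_sphere_holds : isStablyParallelizable_sphere := by
  intro n
  haveI : Fact (finrank ℝ (EuclideanSpace ℝ (Fin (n + 1))) = n + 1) :=
    ⟨finrank_euclideanSpace_fin⟩
  exact isStablyParallelizable_sphere_of_fact

/-- **Every sphere `𝕊ⁿ` is spin**: discharge of the named fact `Literature.Topology.FourManifolds.isSpin_sphere` of
`Spin.lean` — orientable (`isOrientable_sphere_holds`) and stably parallelizable
(`isStablyParallelizable_sphere_holds`), hence spin (`isSpin_of_isStablyParallelizable`;
Lawson–Michelsohn, *Spin Geometry*, Ch. II, Remark 1.9 and the examples following Thm 2.1: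
`w(T𝕊ⁿ) = 1`). [cite: LawsonMichelsohn1989, Ch. II Thm 2.1 and examples] -/
theorem isSpin_sphere_holds : isSpin_sphere := fun n ↦
  isSpin_of_isStablyParallelizable (isOrientable_sphere_holds n)
    (isStablyParallelizable_sphere_holds n)

end Spheres

end Literature.Topology.FourManifolds
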